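import Summits.BirchSwinnertonDyer.Rank1Residual.GaloisImage.TwoLagrangianLinesPlaces
import Summits.BirchSwinnertonDyer.Rank1Residual.Additive.X4RankZeroVisibleLowerBound
import HarnessLib

/-!
# The visibility END for X4 ∧ `r = 0` at `p = 3` over the REFINED certificate with seven free kinds
# (cell `b2b-bsdres`, team n1011, row T-2LL FILE 5 = the END the T-NSK-REC / PASS⁺ records consume;
# seat p04 GEN 11; lead R5-86 (r) / R5-87)

HONEST FRAMING (cell `b2b-bsdres`, run/shared/lean/b2b/bsd-rank1-residual/, verbatim in every
file): the goal of the cell is to DELETE the COMBINATION-SHAPED residual classes of the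
Birch–Swinnerton-Dyer formula for ALL analytic-rank `≤ 1` elliptic curves over `ℚ` — "full BSD
formula for every rank `≤ 1` curve in class `C`" assembled STRICTLY from published theorems — so
that the rank-`≤ 1` remainder becomes exactly the CONSTRUCTION-SHAPED classes, which are TYPED
(missing-input `Prop`s), NOT attempted. This is not "finishing BSD". Team n1011 (N10 / N11, the
additive block X4 ∧ `p = 3`): research route on the CONSTRUCTION-SHAPED class X4; no claim beyond
the stated classes; nothing is booked; no mark / label / count is changed by this file. Theorems
only (no definition, no new named fact, no `sorry`). END theorems: CONDITIONAL on the displayed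
named facts (the UPPER-half facts of n1011-p03's X4 ∧ `r = 0` chain — Kato 14.5, Delbourgo Prop. 4,
Gross–Zagier–Kolyvagin, modularity data, Wuthrich — the Tate-uniformisation facts A40/A41 and
Cassels–Tate A24); they CLOSE NOTHING by themselves — a per-row RECORD must discharge `θ`, the
partner's rank budget `hT`, the bad-place list `hS` and every disjunct of `hplaces` in the kernel, and
carries `hr`, `hq`/`hv` (`r_an`, `#Ш_an`) as EVIDENCE binders (the records' ruling of record,
n1011 lead R5-82 (d)).

## What

n1011-p17's `X4RankZero.bsdp_three_[potMult_]of_congr_of_indexChecks[_of_kato]`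
(`X4RankZeroVisibleIndexLowerBound.lean`) serve the PASS-rank rows: every place of `S` is paid or of
kind (i) (`hloc : #E′(ℚ_v)[3] = 1`). The 268 PASS⁺ rows (route planner 1, ROUTE-1 §41.9), the K44
rows (§44, kind (vii)) and the PASS-T rows (§42, kind (iii′)) need a FREE place of another kind. This
file is the same END over the REFINED certificate `Visible.exists_sha_ne_zero_three_of_congr_of_places₇`
(FILE 3): kinds (i), (ii), (iii), (iv′), (vi), (iii′), (vii) off `T`, the crude factor on `T`, and the
budget `∏_T … < 3^{rank E′}` as a binder (to be fed by a rank certificate, e.g. p17's index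
certificates through `pow_mordellWeilRank_le_index_range_zsmul`, or displayed):

* `X4RankZero.bsdp_three_of_congr_of_places₇_of_kato` — potentially GOOD at `3` (Kato's upper half,
  `¬ 3 ∣ ∏ c_v`, Manin datum), tail = p03's `X4RankZero.bsdp_of_missingLowerBoundAt_of_kato`;
* `X4RankZero.bsdp_three_potMult_of_congr_of_places₇` — potentially MULTIPLICATIVE at `3`, `ρ̄_{E,3}`
  onto, tail = p03's `X4RankZero.bsdp_three_potMult_of_selmerGroup_ne_bot_noL20` through
  `Sel⁽³⁾(E) ↠ Ш(E)[3]` (`exists_selmerToSha_eq`).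

References: [CremonaMazur2000] §3 and Table 1; [AgasheStein2002] Thm. 3.1; [Kato2004Asterisque]
Thm. 14.5; [Delbourgo1998] Prop. 4; [SilvermanAEC2009] X.4.2, X.4.14; [SilvermanATAEC1994] Ch. V;
cells/n1011/ROUTE-1.md §41.9, §44.
-/

set_option autoImplicit false

noncomputable section

open scoped Classical NumberField
open IsDedekindDomain NumberField WeierstrassCurve
  Literature.NumberTheory.EllipticCurves Literature.NumberTheory.EllipticCurves.ModularForms
  Literature.NumberTheory.EllipticCurves.Rank1Residual
  Literature.NumberTheory.EllipticCurves.Rank1Residual.Typed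
  Literature.NumberTheory.GaloisRepresentations
  Summit.BirchSwinnertonDyer.Rank1Residual.GaloisImage

namespace Summit.BirchSwinnertonDyer.Rank1Residual.Additive

/-- **X4 ∧ `r = 0`, potentially GOOD at `3`, `ord₃ #Ш_an ≤ 2`: `BSD(E,3)` from Kato's UPPER half and a
VISIBLE element of `Ш(E)[3]` from the REFINED seven-kind certificate** — p17's
`X4RankZero.bsdp_three_of_congr_of_indexChecks_of_kato` with the crude count replaced by
`Visible.exists_sha_ne_zero_three_of_congr_of_places₇` (T-2LL FILE 3): pay `#E′(ℚ_w)[3]·#(ℤ_w/3)` on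
`T` against the binder `hT` (`< 3^{rank E′}`), every place of `S ∖ T` free of kind (i), (ii), (iii),
(iv′), (vi), (iii′) or (vii). Conditional on `hKato`, `hCT`, `hGZK`, `hmod`, `hU`, `hU2`; closes
nothing until a record discharges the certificate. [cite: CremonaMazur2000, §3 and Table 1]
[cite: AgasheStein2002, Thm. 3.1] [cite: Kato2004Asterisque, Thm. 14.5 (3) (p. 236)]
[cite: SilvermanAEC2009, Thm. X.4.14] -/
theorem X4RankZero.bsdp_three_of_congr_of_places₇_of_kato
    (hKato : Kato2004.rankZero_padicValNat_sha_le_of_additive_potGood_of_imageContainsSL2)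
    (hCT : exists_casselsTate_pairing (K := ℚ))
    (hGZK : rank_eq_analyticRank_of_analyticRank_le_one) (hmod : hasEntireLFunction_rat)
    (W : WeierstrassCurve ℚ) [W.IsElliptic] [W.IsGloballyMinimal]
    (hr : W.analyticRank = 0) (hX : haveI : Fact (Nat.Prime 3) := ⟨Nat.prime_three⟩; ClassX4 W 3)
    (hpot : 0 ≤ padicValRat 3 W.j)
    (hsurj : ∀ n : ℕ, W.HasSurjectiveModNGaloisRep (3 ^ n : ℕ)) (htam : ¬ 3 ∣ W.tamagawaProduct)
    {N : ℕ} [NeZero N] (D : ModularParametrizationData W N) (hc : ¬ (3 : ℤ) ∣ D.maninConstant)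
    {q : ℚ} (hq : shaAn W = (q : ℂ)) (hv : padicValRat 3 q ≤ 2)
    (hU : Silverman1994_thmV53_tateUniformisation.{0})
    (hU2 : Silverman1994_thmV53_corV54_tateUniformisation.{0})
    (W' : WeierstrassCurve ℚ) [W'.IsElliptic]
    (θ : geomTorsion W' ((3 : ℕ) : ℤ) ≃+ geomTorsion W ((3 : ℕ) : ℤ))
    (hθ : ∀ (σ : Field.absoluteGaloisGroup ℚ) (P : geomTorsion W' ((3 : ℕ) : ℤ)),
      θ (σ • P) = σ • θ P)
    (S T : Finset (HeightOneSpectrum (𝓞 ℚ))) (hTS : T ⊆ S)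
    (hS : ∀ w : HeightOneSpectrum (𝓞 ℚ), w ∉ S →
      W.HasGoodReductionAt w ∧ W'.HasGoodReductionAt w ∧ ((3 : ℕ) : 𝓞 ℚ) ∉ w.asIdeal)
    (hT : (∏ w ∈ T, Nat.card (nsmulAddMonoidHom 3 :
        (W'.baseChange (w.adicCompletion ℚ)).toAffine.Point →+ _).ker *
        Nat.card (w.adicCompletionIntegers ℚ ⧸
          Ideal.span {((3 : ℕ) : w.adicCompletionIntegers ℚ)})) < 3 ^ W'.mordellWeilRank)
    (hplaces : ∀ w ∈ S, w ∉ T →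
      (((3 : ℕ) : 𝓞 ℚ) ∉ w.asIdeal ∧ Nat.card (nsmulAddMonoidHom 3 :
          (W'.baseChange (w.adicCompletion ℚ)).toAffine.Point →+ _).ker = 1) ∨
      (W.HasSplitMultiplicativeReductionAt w ∧ W'.HasSplitMultiplicativeReductionAt w ∧
        Nat.card (nsmulAddMonoidHom 3 :
          (W.baseChange (w.adicCompletion ℚ)).toAffine.Point →+ _).ker ≤ 3) ∨
      (W.HasMultiplicativeReductionAt w ∧ W'.HasMultiplicativeReductionAt w ∧
        (∃ r : w.adicCompletion ℚ, algebraMap ℚ (w.adicCompletion ℚ) (-(W.c₄ / W.c₆)) =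
          r ^ 2 * algebraMap ℚ (w.adicCompletion ℚ) (-(W'.c₄ / W'.c₆))) ∧
        (∀ ζ : w.adicCompletion ℚ, ζ ^ 3 = 1 → ζ = 1)) ∨
      (W.HasMultiplicativeReductionAt w ∧
        ¬ IsSquare (algebraMap ℚ (w.adicCompletion ℚ) (-(W.c₄ / W.c₆))) ∧
        W'.HasGoodReductionAt w ∧ ((3 : ℕ) : 𝓞 ℚ) ∉ w.asIdeal) ∨
      (W.HasGoodReductionAt w ∧ W'.HasMultiplicativeReductionAt w ∧
        ¬ IsSquare (algebraMap ℚ (w.adicCompletion ℚ) (-(W'.c₄ / W'.c₆))) ∧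
        ((3 : ℕ) : 𝓞 ℚ) ∉ w.asIdeal) ∨
      (1 < w.valuation ℚ W.j ∧ 1 < w.valuation ℚ W'.j ∧
        (∃ r : w.adicCompletion ℚ, algebraMap ℚ (w.adicCompletion ℚ) (-(W.c₄ / W.c₆)) =
          r ^ 2 * algebraMap ℚ (w.adicCompletion ℚ) (-(W'.c₄ / W'.c₆))) ∧
        (∀ ζ : w.adicCompletion ℚ, ζ ^ 3 = 1 → ζ = 1)) ∨
      (W.HasAdditiveReductionAt w ∧ W'.HasAdditiveReductionAt w ∧ ((3 : ℕ) : 𝓞 ℚ) ∉ w.asIdeal ∧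
        Nat.card (nsmulAddMonoidHom 3 :
          (W'.baseChange (w.adicCompletion ℚ)).toAffine.Point →+ _).ker = 3)) :
    haveI : Fact (Nat.Prime 3) := ⟨Nat.prime_three⟩
    BSDp W 3 := by
  haveI : Fact (Nat.Prime 3) := ⟨Nat.prime_three⟩
  have hfin : Finite W.toAffine.Point := finite_point_of_analyticRank_eq_zero W hGZK hr
  have hirr : Irr W 3 :=
    hasIrreducibleModPGaloisRep_of_hasSurjectiveModNGaloisRep W 3 (by simpa using hsurj 1)
  have hvis : ∃ c : W.sha, c ≠ 0 ∧ 3 • c = 0 :=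
    Visible.exists_sha_ne_zero_three_of_congr_of_places₇ hU hU2 W W' θ hθ S T hTS hS hfin
      (coprime_natCard_point_of_irr W 3 hirr) hT hplaces
  have hlow : MissingLowerBoundAt W 3 :=
    missingLowerBoundAt_of_casselsTate_of_pow_dvd W 3 hCT (hGZK W (by rw [hr]; exact Nat.zero_le 1)).2
      hq (k := 1) (by simpa using hv) (by simpa using dvd_shaOrder_of_exists_torsion W 3 hvis)
  exact X4RankZero.bsdp_of_missingLowerBoundAt_of_kato W 3 hKato hGZK hmod hr hX hpot hsurj htam D hc
    hlow

/-- **X4 ∧ `r = 0`, potentially MULTIPLICATIVE at `3`, `ρ̄_{E,3}` onto, `ord₃ #Ш_an ≤ 2`: `BSD(E,3)`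
from the (M)-chain UPPER half and a VISIBLE element of `Ш(E)[3]` from the REFINED seven-kind
certificate** — p17's `X4RankZero.bsdp_three_potMult_of_congr_of_indexChecks` with the crude count
replaced by `Visible.exists_sha_ne_zero_three_of_congr_of_places₇` (T-2LL FILE 3); tail through
`Sel⁽³⁾(E) ↠ Ш(E)[3]` and p03's `X4RankZero.bsdp_three_potMult_of_selmerGroup_ne_bot_noL20`.
Conditional on `hKatoS`, `hDel`, `hGZK`, `hmod`, `hmodD`, `hKatoχ`, `hCT`, `hU`, `hU2`; closes nothing
until a record discharges the certificate. [cite: CremonaMazur2000, §3 and Table 1]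
[cite: AgasheStein2002, Thm. 3.1] [cite: Delbourgo1998, Prop. 4 (p. 144)]
[cite: SilvermanAEC2009, Thm. X.4.2 (a) and X.4.14] -/
theorem X4RankZero.bsdp_three_potMult_of_congr_of_places₇
    (hKatoS : Kato2004.rankZero_padicValNat_sha_le_sub_localTamagawa_of_additive_potGood_of_imageContainsSL2)
    (hDel : Delbourgo1998.prop4_rankZero_pow_dvd_constantCoeff)
    (hGZK : rank_eq_analyticRank_of_analyticRank_le_one) (hmod : hasEntireLFunction_rat)
    (hmodD : nonempty_modularParametrizationData)
    (hKatoχ : Wuthrich2014.kato_halfEigenCharIdeal_dvd_cyclotomicPrime_of_surjective)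
    (hCT : exists_casselsTate_pairing (K := ℚ))
    (W : WeierstrassCurve ℚ) [W.IsElliptic] [W.IsGloballyMinimal] (hr : W.analyticRank = 0)
    (hX : haveI : Fact (Nat.Prime 3) := ⟨Nat.prime_three⟩; ClassX4 W 3)
    (hsurj : W.HasSurjectiveModNGaloisRep 3) (hj : padicValRat 3 W.j < 0)
    {q : ℚ} (hq : shaAn W = (q : ℂ)) (hv : padicValRat 3 q ≤ 2)
    (hU : Silverman1994_thmV53_tateUniformisation.{0})
    (hU2 : Silverman1994_thmV53_corV54_tateUniformisation.{0})
    (W' : WeierstrassCurve ℚ) [W'.IsElliptic]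
    (θ : geomTorsion W' ((3 : ℕ) : ℤ) ≃+ geomTorsion W ((3 : ℕ) : ℤ))
    (hθ : ∀ (σ : Field.absoluteGaloisGroup ℚ) (P : geomTorsion W' ((3 : ℕ) : ℤ)),
      θ (σ • P) = σ • θ P)
    (S T : Finset (HeightOneSpectrum (𝓞 ℚ))) (hTS : T ⊆ S)
    (hS : ∀ w : HeightOneSpectrum (𝓞 ℚ), w ∉ S →
      W.HasGoodReductionAt w ∧ W'.HasGoodReductionAt w ∧ ((3 : ℕ) : 𝓞 ℚ) ∉ w.asIdeal)
    (hT : (∏ w ∈ T, Nat.card (nsmulAddMonoidHom 3 :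
        (W'.baseChange (w.adicCompletion ℚ)).toAffine.Point →+ _).ker *
        Nat.card (w.adicCompletionIntegers ℚ ⧸
          Ideal.span {((3 : ℕ) : w.adicCompletionIntegers ℚ)})) < 3 ^ W'.mordellWeilRank)
    (hplaces : ∀ w ∈ S, w ∉ T →
      (((3 : ℕ) : 𝓞 ℚ) ∉ w.asIdeal ∧ Nat.card (nsmulAddMonoidHom 3 :
          (W'.baseChange (w.adicCompletion ℚ)).toAffine.Point →+ _).ker = 1) ∨
      (W.HasSplitMultiplicativeReductionAt w ∧ W'.HasSplitMultiplicativeReductionAt w ∧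
        Nat.card (nsmulAddMonoidHom 3 :
          (W.baseChange (w.adicCompletion ℚ)).toAffine.Point →+ _).ker ≤ 3) ∨
      (W.HasMultiplicativeReductionAt w ∧ W'.HasMultiplicativeReductionAt w ∧
        (∃ r : w.adicCompletion ℚ, algebraMap ℚ (w.adicCompletion ℚ) (-(W.c₄ / W.c₆)) =
          r ^ 2 * algebraMap ℚ (w.adicCompletion ℚ) (-(W'.c₄ / W'.c₆))) ∧
        (∀ ζ : w.adicCompletion ℚ, ζ ^ 3 = 1 → ζ = 1)) ∨
      (W.HasMultiplicativeReductionAt w ∧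
        ¬ IsSquare (algebraMap ℚ (w.adicCompletion ℚ) (-(W.c₄ / W.c₆))) ∧
        W'.HasGoodReductionAt w ∧ ((3 : ℕ) : 𝓞 ℚ) ∉ w.asIdeal) ∨
      (W.HasGoodReductionAt w ∧ W'.HasMultiplicativeReductionAt w ∧
        ¬ IsSquare (algebraMap ℚ (w.adicCompletion ℚ) (-(W'.c₄ / W'.c₆))) ∧
        ((3 : ℕ) : 𝓞 ℚ) ∉ w.asIdeal) ∨
      (1 < w.valuation ℚ W.j ∧ 1 < w.valuation ℚ W'.j ∧
        (∃ r : w.adicCompletion ℚ, algebraMap ℚ (w.adicCompletion ℚ) (-(W.c₄ / W.c₆)) =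
          r ^ 2 * algebraMap ℚ (w.adicCompletion ℚ) (-(W'.c₄ / W'.c₆))) ∧
        (∀ ζ : w.adicCompletion ℚ, ζ ^ 3 = 1 → ζ = 1)) ∨
      (W.HasAdditiveReductionAt w ∧ W'.HasAdditiveReductionAt w ∧ ((3 : ℕ) : 𝓞 ℚ) ∉ w.asIdeal ∧
        Nat.card (nsmulAddMonoidHom 3 :
          (W'.baseChange (w.adicCompletion ℚ)).toAffine.Point →+ _).ker = 3)) :
    haveI : Fact (Nat.Prime 3) := ⟨Nat.prime_three⟩
    BSDp W 3 := by
  haveI : Fact (Nat.Prime 3) := ⟨Nat.prime_three⟩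
  have hfin : Finite W.toAffine.Point := finite_point_of_analyticRank_eq_zero W hGZK hr
  have hirr : Irr W 3 := hasIrreducibleModPGaloisRep_of_hasSurjectiveModNGaloisRep W 3 hsurj
  have hvis : ∃ c : W.sha, c ≠ 0 ∧ 3 • c = 0 :=
    Visible.exists_sha_ne_zero_three_of_congr_of_places₇ hU hU2 W W' θ hθ S T hTS hS hfin
      (coprime_natCard_point_of_irr W 3 hirr) hT hplaces
  obtain ⟨c, hc0, hc3⟩ := hvis
  -- `Sel^(3)(E/ℚ) ↠ Ш(E/ℚ)[3]`: a preimage of the visible class is a non-zero Selmer element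
  obtain ⟨z, hz⟩ := exists_selmerToSha_eq W (n := ((3 : ℕ) : ℤ)) (by norm_num) c (by exact_mod_cast hc3)
  have hSel : W.selmerGroup ((3 : ℕ) : ℤ) ≠ ⊥ := by
    intro hbot
    have hmem : (z : W.galH1Torsion ((3 : ℕ) : ℤ)) ∈ (⊥ : AddSubgroup _) := hbot ▸ z.2
    have hz0 : z = 0 := Subtype.ext ((AddSubgroup.mem_bot).mp hmem)
    exact hc0 (by rw [← hz, hz0, map_zero])
  exact X4RankZero.bsdp_three_potMult_of_selmerGroup_ne_bot_noL20 W hKatoS hDel hGZK hmod hmodD hKatoχ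
    hCT hr hX hsurj hj hq hv hSel

end Summit.BirchSwinnertonDyer.Rank1Residual.Additive

end
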